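import Summits.Ventures.CertifiedManyBodySolver.Observables.BraggWeightAtomic
import Literature.Probability.LatticeModels.TorusFourierProofs
import HarnessLib

/-!
# Periodic one-point patterns: the autocorrelation is a trigonometric polynomial with weights `|f̂(k)|²`

HONEST FRAMING: first certified bounds; not a superconductivity verdict; every number certified or labelled float.

Speedrun `mbsolver`, seat sr-mbsolver-lit-1 (literature team), gen 12.  Pure harmonic analysis on the
discrete torus; zero compute; no state, no certificate, no named fact, no number of record.  This is the
finite-Fourier identity deliberately left out of `Observables/BraggWeightAtomic.lean` (§"Not here"): it closes
the DICTIONARY "printed periodic one-point profile `f` ↦ implied Bragg weights `|f̂(Q)|²`" of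
`HOME/lit/stripe_print_comparator_D2.md` §1 at the kernel level, for EVERY period `L` and EVERY dimension `d`.

## Content (all `L ≥ 1`, `d` arbitrary; the torus is `TorusSite d L = Fin d → ZMod L` of
`Literature/Probability/LatticeModels/LatticeGraph.lean`, its characters `torusChar` and Fourier sum
`torusFourier` are REUSED from `Literature/Probability/LatticeModels/TorusFourier{,Proofs}.lean`)

* `toTorus L r` — reduction `ℤᵈ → (ℤ/Lℤ)ᵈ`; `dualVec k = (2π · valMinAbs (k i) / L)ᵢ` — the dual-grid
  wavevector of `k ∈ (ℤ/Lℤ)ᵈ` folded into the cell `(−π, π]ᵈ` (`dualVec_mem_Ioc`), injective in `k`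
  (`dualVec_injective`); `exp_dualVec_eq_torusChar` : `e^{i r·dualVec k} = χ_k(toTorus r)`.
* `fourierCoeff f k = L^{-d} Σ_x f(x) conj χ_k(x)` (normalised; `= L^{-d} · torusFourier f k`) and the
  translation-averaged AUTOCORRELATION `autocorr f z = L^{-d} Σ_x conj (f x) · f (x + z)`;
  `fourierCoeff_zero` (the mean), `fourierCoeff_sub_const` / `fourierCoeff_sub_mean_zero` (subtracting the mean
  — the CONNECTED autocorrelation — kills the atom at `k = 0` and changes nothing else).
* **`autocorr_eq_sum_fourierCoeff`** : `autocorr f z = Σ_k |fourierCoeff f k|² χ_k(z)` (character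
  orthogonality, `sum_mul_sum_torusChar_sub`).
* `trigPoly_pattern` : along an enumeration of the torus, `r ↦ autocorr f (toTorus r)` IS the trigonometric
  polynomial `trigPoly (patternVec d L) (patternWt f)` of `BraggWeightAtomic.lean`, with atoms `dualVec k` (in the
  cell, pairwise distinct) and weights `|fourierCoeff f k|²`; hence `atomicMeasure … ` represents it
  (`atomicMeasure_represents_autocorr`).
* **`braggWeight_of_represents_autocorr`** : for EVERY finite measure `μ` on `ℝᵈ` representing
  `r ↦ autocorr f (toTorus r)` (Herglotz form `∫ e^{i r·ξ} dμ = C r`), the Bragg weight at the dual-grid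
  wavevector `dualVec k` is exactly `|fourierCoeff f k|²`, and (`braggWeight_eq_zero_of_represents_autocorr`) it is
  `0` at every other wavevector of the cell (representation independence = Wiener, `BraggWeightWiener.lean`);
  `braggWeight_of_represents_connected_autocorr` / `braggWeight_origin_of_represents_connected_autocorr` : the
  same for the connected autocorrelation (`|f̂(k)|²` at `k ≠ 0`, `0` at the origin);
  `braggWeight_of_represents_autocorr_le` : Parseval bound `≤ L^{-d} Σ_x |f x|²`.
* `d = 2` readings at the M3 stars: period `8`, `k = (1, 0)` ↦ `Q_c = (π/4, 0)`; period `16`, `k = (7, 8)` ↦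
  `Q_s = (7π/8, π)` (`braggWeight_chargeArm_of_represents_autocorr`, `braggWeight_spinArm_of_represents_autocorr`).

## Not here

Nothing about a Hubbard state, a row or a certificate; no D₄ orbit mean (the per-arm halving for a
unidirectional pattern is `BraggWeightAtomic.braggWeight_arm_of_represents_stripeXOrbit`); no numerical
evaluation of any `|f̂(k)|²` (the comparator file's implied weights stay FLOAT context).
-/

noncomputable section

namespace Summit.Ventures.CertifiedManyBodySolver.Observables

open MeasureTheory Complex Filter Topology Finset ZMod
open Literature.Probability.LatticeModels
open scoped Real BigOperators NNReal ENNReal ComplexConjugate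

variable {d L : ℕ}

/-! ### §1. The torus `(ℤ/Lℤ)ᵈ`, its dual grid folded into the cell, and the characters -/

/-- Reduction of a lattice vector `r ∈ ℤᵈ` to the torus `(ℤ/Lℤ)ᵈ`. -/
def toTorus (L : ℕ) (r : Fin d → ℤ) : TorusSite d L := fun i => (r i : ZMod L)

/-- `toTorus` is additive. -/
theorem toTorus_add (L : ℕ) (r s : Fin d → ℤ) : toTorus L (r + s) = toTorus L r + toTorus L s := by
  funext i; simp [toTorus]

/-- The dual-grid wavevector of `k ∈ (ℤ/Lℤ)ᵈ`, folded into the cell `(−π, π]ᵈ`: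
`(dualVec k) i = 2π · valMinAbs (k i) / L` (the balanced representative `valMinAbs ∈ (−L/2, L/2]`). -/
def dualVec (k : TorusSite d L) : Fin d → ℝ := fun i => 2 * π * ((k i).valMinAbs : ℝ) / L

/-- Coordinates of `dualVec k`. -/
@[simp] theorem dualVec_apply (k : TorusSite d L) (i : Fin d) :
    dualVec k i = 2 * π * ((k i).valMinAbs : ℝ) / L := rfl

variable [NeZero L]

/-- The folded dual-grid wavevectors lie in the cell `(−π, π]ᵈ`. -/
theorem dualVec_mem_Ioc (k : TorusSite d L) (i : Fin d) : dualVec k i ∈ Set.Ioc (-π) π := by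
  have hL : (0 : ℝ) < L := Nat.cast_pos.mpr (Nat.pos_of_ne_zero (NeZero.ne L))
  have hπ := Real.pi_pos
  have hv := ZMod.valMinAbs_mem_Ioc (k i)
  obtain ⟨h1, h2⟩ := hv
  have h1' : -(L : ℝ) < (k i).valMinAbs * 2 := by exact_mod_cast h1
  have h2' : ((k i).valMinAbs : ℝ) * 2 ≤ L := by exact_mod_cast h2
  rw [dualVec_apply, Set.mem_Ioc]
  constructor
  · rw [lt_div_iff₀ hL]; nlinarith
  · rw [div_le_iff₀ hL]; nlinarith

/-- Distinct torus momenta give distinct cell wavevectors. -/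
theorem dualVec_injective : Function.Injective (dualVec (d := d) (L := L)) := by
  intro k k' h
  funext i
  have hL : (L : ℝ) ≠ 0 := Nat.cast_ne_zero.mpr (NeZero.ne L)
  have hi := congrFun h i
  simp only [dualVec_apply] at hi
  have hc : (2 * π / (L : ℝ)) ≠ 0 := by positivity
  have key : (2 * π / (L : ℝ)) * ((k i).valMinAbs : ℝ) = (2 * π / (L : ℝ)) * ((k' i).valMinAbs : ℝ) := by
    rw [div_mul_eq_mul_div, div_mul_eq_mul_div]; exact hi
  have := mul_left_cancel₀ hc key
  exact ZMod.injective_valMinAbs (by exact_mod_cast this)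

/-- **The link**: the lattice phase at the folded dual-grid wavevector IS the torus character,
`e^{i r·dualVec k} = χ_k(toTorus r)` (both equal `∏ᵢ e^{2πi rᵢ valMinAbs(kᵢ)/L}`). -/
theorem exp_dualVec_eq_torusChar (k : TorusSite d L) (r : Fin d → ℤ) :
    exp ((∑ i, (r i : ℝ) * dualVec k i : ℝ) * I) = torusChar k (toTorus L r) := by
  unfold torusChar
  rw [Complex.ofReal_sum, Finset.sum_mul, Complex.exp_sum]
  refine Finset.prod_congr rfl fun i _ => ?_
  have hk : k i * toTorus L r i = (((k i).valMinAbs * r i : ℤ) : ZMod L) := by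
    simp [toTorus, ZMod.coe_valMinAbs]
  rw [hk, ZMod.stdAddChar_coe]
  congr 1
  simp only [dualVec_apply]
  push_cast
  ring

/-! ### §2. Normalised Fourier coefficients and the autocorrelation of a pattern -/

variable (f : TorusSite d L → ℂ)

/-- The normalised Fourier coefficient `f̂(k) = L^{-d} Σ_x f(x) conj χ_k(x) = L^{-d} Σ_x f(x) e^{-2πi k·x/L}`. -/
def fourierCoeff (k : TorusSite d L) : ℂ := ((L : ℂ) ^ d)⁻¹ * torusFourier f k

/-- The translation-averaged AUTOCORRELATION of the pattern: `C_f(z) = L^{-d} Σ_x conj (f x) · f (x + z)`. -/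
def autocorr (z : TorusSite d L) : ℂ := ((L : ℂ) ^ d)⁻¹ * ∑ x, conj (f x) * f (x + z)

/-- `f̂(k) = L^{-d} Σ_x f(x) conj χ_k(x)` (character form of `torusFourier`). -/
theorem fourierCoeff_eq_sum (k : TorusSite d L) :
    fourierCoeff f k = ((L : ℂ) ^ d)⁻¹ * ∑ x, f x * conj (torusChar k x) := by
  rw [fourierCoeff, torusFourier_eq_sum_torusChar]

/-- The zeroth coefficient is the MEAN of the pattern: `f̂(0) = L^{-d} Σ_x f x`. -/
theorem fourierCoeff_zero : fourierCoeff f 0 = ((L : ℂ) ^ d)⁻¹ * ∑ x, f x := by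
  rw [fourierCoeff, torusFourier_apply_zero]

/-- Character sums vanish off `k = 0`: `Σ_x conj χ_k(x) = 0` for `k ≠ 0`. -/
theorem sum_conj_torusChar_eq_zero {k : TorusSite d L} (hk : k ≠ 0) : ∑ x, conj (torusChar k x) = 0 := by
  rw [← map_sum, sum_torusChar_right, if_neg hk, map_zero]

/-- Subtracting a constant — e.g. the mean `f̂(0)`, which gives the CONNECTED autocorrelation — changes no
Fourier coefficient off `k = 0`. -/
theorem fourierCoeff_sub_const (c : ℂ) {k : TorusSite d L} (hk : k ≠ 0) :
    fourierCoeff (fun x => f x - c) k = fourierCoeff f k := by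
  rw [fourierCoeff_eq_sum, fourierCoeff_eq_sum]
  congr 1
  simp_rw [sub_mul, Finset.sum_sub_distrib, ← Finset.mul_sum, sum_conj_torusChar_eq_zero hk, mul_zero, sub_zero]

/-- The mean-subtracted pattern has zeroth coefficient `0` (no atom at the origin). -/
theorem fourierCoeff_sub_mean_zero : fourierCoeff (fun x => f x - fourierCoeff f 0) 0 = 0 := by
  rw [fourierCoeff_zero, fourierCoeff_zero, Finset.sum_sub_distrib, Finset.sum_const, Finset.card_univ,
    Fintype.card_pi, Finset.prod_const, ZMod.card, Finset.card_univ, Fintype.card_fin, nsmul_eq_mul, mul_sub,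
    ← mul_assoc, Nat.cast_pow, inv_mul_cancel₀ natCast_pow_ne_zero, one_mul, sub_self]

/-- `|f̂(k)|²` as a complex number: `conj f̂(k) · f̂(k)`, expanded. -/
theorem normSq_fourierCoeff_eq (k : TorusSite d L) :
    ((‖fourierCoeff f k‖ ^ 2 : ℝ) : ℂ)
      = ((L : ℂ) ^ d)⁻¹ * ((L : ℂ) ^ d)⁻¹ *
          ((∑ x, conj (f x) * torusChar k x) * ∑ y, f y * conj (torusChar k y)) := by
  push_cast
  rw [← Complex.conj_mul', fourierCoeff_eq_sum]
  have hc : conj (((L : ℂ) ^ d)⁻¹) = ((L : ℂ) ^ d)⁻¹ := by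
    rw [map_inv₀, map_pow, Complex.conj_natCast]
  rw [map_mul, hc, map_sum]
  simp_rw [map_mul, Complex.conj_conj]
  ring

/-- **The finite-Fourier identity**: the autocorrelation of a periodic pattern is the trigonometric polynomial
with weights `|f̂(k)|²` on the dual grid, `C_f(z) = Σ_k |f̂(k)|² χ_k(z)`. -/
theorem autocorr_eq_sum_fourierCoeff (z : TorusSite d L) :
    autocorr f z = ∑ k, ((‖fourierCoeff f k‖ ^ 2 : ℝ) : ℂ) * torusChar k z := by
  simp_rw [normSq_fourierCoeff_eq]
  have hkey : ∀ k : TorusSite d L,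
      (∑ x, conj (f x) * torusChar k x) * (∑ y, f y * conj (torusChar k y)) * torusChar k z
        = ∑ x, conj (f x) * ∑ y, f y * torusChar k (x + z - y) := by
    intro k
    rw [Finset.sum_mul, Finset.sum_mul]
    refine Finset.sum_congr rfl fun x _ => ?_
    have hy : ∑ y, f y * torusChar k (x + z - y)
        = torusChar k x * torusChar k z * ∑ y, f y * conj (torusChar k y) := by
      rw [Finset.mul_sum]
      refine Finset.sum_congr rfl fun y _ => ?_
      rw [torusChar_sub_right, torusChar_add_right]
      ring
    rw [hy]
    ring
  set c : ℂ := ((L : ℂ) ^ d)⁻¹ with hcdef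
  have hcL : c * (L : ℂ) ^ d = 1 := inv_mul_cancel₀ natCast_pow_ne_zero
  calc autocorr f z
      = c * c * ∑ x, conj (f x) * ((L : ℂ) ^ d * f (x + z)) := by
        have hs : ∑ x, conj (f x) * ((L : ℂ) ^ d * f (x + z)) = (L : ℂ) ^ d * ∑ x, conj (f x) * f (x + z) := by
          rw [Finset.mul_sum]
          exact Finset.sum_congr rfl fun x _ => by ring
        rw [hs, ← mul_assoc, mul_assoc c c, hcL, mul_one]
        rfl
    _ = c * c * ∑ x, conj (f x) * ∑ y, f y * ∑ k, torusChar k (x + z - y) := by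
        simp_rw [sum_mul_sum_torusChar_sub]
    _ = c * c * ∑ k, ∑ x, conj (f x) * ∑ y, f y * torusChar k (x + z - y) := by
        congr 1
        rw [Finset.sum_comm]
        refine Finset.sum_congr rfl fun x _ => ?_
        simp_rw [Finset.mul_sum]
        rw [Finset.sum_comm]
    _ = ∑ k, c * c *
          ((∑ x, conj (f x) * torusChar k x) * (∑ y, f y * conj (torusChar k y))) * torusChar k z := by
        rw [Finset.mul_sum]
        refine Finset.sum_congr rfl fun k _ => ?_
        rw [mul_assoc (c * c), hkey k]

/-- The autocorrelation at `0` is the mean modulus square: `C_f(0) = L^{-d} Σ_x |f x|²`. -/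
theorem autocorr_zero : autocorr f 0 = ((L : ℂ) ^ d)⁻¹ * ∑ x, ((‖f x‖ ^ 2 : ℝ) : ℂ) := by
  simp [autocorr, Complex.conj_mul']

/-- Parseval in this normalisation: `Σ_k |f̂(k)|² = L^{-d} Σ_x |f x|²` (`= C_f(0)`). -/
theorem sum_normSq_fourierCoeff :
    ∑ k, ((‖fourierCoeff f k‖ ^ 2 : ℝ) : ℂ) = ((L : ℂ) ^ d)⁻¹ * ∑ x, ((‖f x‖ ^ 2 : ℝ) : ℂ) := by
  rw [← autocorr_zero, autocorr_eq_sum_fourierCoeff]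
  simp

/-! ### §3. The autocorrelation as a `trigPoly` of `BraggWeightAtomic.lean`; representing measures -/

/-- The atoms: the folded dual-grid wavevectors along the enumeration `Fintype.equivFin` of the torus. -/
def patternVec (d L : ℕ) [NeZero L] : Fin (Fintype.card (TorusSite d L)) → (Fin d → ℝ) :=
  fun l => dualVec ((Fintype.equivFin (TorusSite d L)).symm l)

/-- The weights: `|f̂(k)|²` along the same enumeration. -/
def patternWt : Fin (Fintype.card (TorusSite d L)) → ℝ≥0 :=
  fun l => ‖fourierCoeff f ((Fintype.equivFin (TorusSite d L)).symm l)‖₊ ^ 2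

/-- The atoms lie in the cell `(−π, π]ᵈ`. -/
theorem patternVec_mem_Ioc : ∀ l i, patternVec d L l i ∈ Set.Ioc (-π) π :=
  fun _ i => dualVec_mem_Ioc _ i

/-- The atoms are pairwise distinct. -/
theorem patternVec_injective : Function.Injective (patternVec d L) :=
  fun _ _ h => (Fintype.equivFin (TorusSite d L)).symm.injective (dualVec_injective h)

/-- The atom with index `equivFin k` is `dualVec k`. -/
@[simp] theorem patternVec_equivFin (k : TorusSite d L) :
    patternVec d L (Fintype.equivFin (TorusSite d L) k) = dualVec k := by
  simp [patternVec]

/-- The weight with index `l`, as a real number, is `|f̂(equivFin⁻¹ l)|²`. -/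
@[simp] theorem coe_patternWt (l : Fin (Fintype.card (TorusSite d L))) :
    (patternWt f l : ℝ) = ‖fourierCoeff f ((Fintype.equivFin (TorusSite d L)).symm l)‖ ^ 2 := by
  simp [patternWt]

/-- **The autocorrelation on `ℤᵈ` is the trigonometric polynomial with atoms `dualVec k` and weights `|f̂(k)|²`.** -/
theorem trigPoly_pattern (r : Fin d → ℤ) :
    trigPoly (patternVec d L) (patternWt f) r = autocorr f (toTorus L r) := by
  rw [autocorr_eq_sum_fourierCoeff, trigPoly]
  rw [← (Fintype.equivFin (TorusSite d L)).symm.sum_comp]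
  refine Finset.sum_congr rfl fun l _ => ?_
  rw [show patternVec d L l = dualVec ((Fintype.equivFin (TorusSite d L)).symm l) from rfl,
    exp_dualVec_eq_torusChar]
  congr 1

/-- Hence the atomic measure `Σ_k |f̂(k)|² δ_{dualVec k}` REPRESENTS the autocorrelation (Herglotz form): the
autocorrelation of a periodic pattern is a positive-definite function with pure point spectral measure. -/
theorem atomicMeasure_represents_autocorr :
    ∀ r : Fin d → ℤ, ∫ ξ, exp ((∑ i, (r i : ℝ) * ξ i : ℝ) * I) ∂(atomicMeasure (patternVec d L) (patternWt f))
      = autocorr f (toTorus L r) :=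
  fun r => by rw [integral_exp_atomicMeasure, trigPoly_pattern]

/-! ### §4. Bragg weights of ANY measure representing the autocorrelation -/

/-- **Dictionary, kernel form.**  For every finite measure `μ` on `ℝᵈ` representing the autocorrelation of the
periodic pattern `f` (e.g. the spectral measure of a translation-invariant state whose two-point function IS that
autocorrelation), the Bragg weight at the dual-grid wavevector `dualVec k` is exactly `|f̂(k)|²`. -/
theorem braggWeight_of_represents_autocorr (μ : Measure (EuclideanSpace ℝ (Fin d))) [IsFiniteMeasure μ]
    (hμ : ∀ r : Fin d → ℤ, ∫ ξ, exp ((∑ i, (r i : ℝ) * ξ i : ℝ) * I) ∂μ = autocorr f (toTorus L r))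
    (k : TorusSite d L) :
    braggWeight μ ![dualVec k] = ‖fourierCoeff f k‖ ^ 2 := by
  have hμ' : ∀ r : Fin d → ℤ, ∫ ξ, exp ((∑ i, (r i : ℝ) * ξ i : ℝ) * I) ∂μ
      = trigPoly (patternVec d L) (patternWt f) r := fun r => by rw [hμ r, trigPoly_pattern]
  have h := braggWeight_eq_of_represents_trigPoly μ hμ' patternVec_mem_Ioc patternVec_injective
    (Fintype.equivFin (TorusSite d L) k)
  rw [patternVec_equivFin, coe_patternWt, Equiv.symm_apply_apply] at h
  exact h

/-- Off the dual grid there is no Bragg weight: at a cell wavevector `Q ∈ (−π, π]ᵈ` that is not of the form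
`dualVec k`, every measure representing the autocorrelation has Bragg weight `0`. -/
theorem braggWeight_eq_zero_of_represents_autocorr (μ : Measure (EuclideanSpace ℝ (Fin d))) [IsFiniteMeasure μ]
    (hμ : ∀ r : Fin d → ℤ, ∫ ξ, exp ((∑ i, (r i : ℝ) * ξ i : ℝ) * I) ∂μ = autocorr f (toTorus L r))
    {Q : Fin d → ℝ} (hQ : ∀ i, Q i ∈ Set.Ioc (-π) π) (hQk : ∀ k : TorusSite d L, dualVec k ≠ Q) :
    braggWeight μ ![Q] = 0 := by
  have hμ' : ∀ r : Fin d → ℤ, ∫ ξ, exp ((∑ i, (r i : ℝ) * ξ i : ℝ) * I) ∂μ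
      = trigPoly (patternVec d L) (patternWt f) r := fun r => by rw [hμ r, trigPoly_pattern]
  exact braggWeight_eq_zero_of_represents_trigPoly μ hμ' patternVec_mem_Ioc hQ fun l => hQk _

/-- **Connected form.**  For a measure representing the CONNECTED autocorrelation (pattern minus its mean
`f̂(0)`, as for the connected density / spin correlations of the certified rows) the Bragg weight at every
NON-ZERO dual-grid wavevector is still `|f̂(k)|²`, and the weight at the origin is `0`. -/
theorem braggWeight_of_represents_connected_autocorr (μ : Measure (EuclideanSpace ℝ (Fin d))) [IsFiniteMeasure μ]
    (hμ : ∀ r : Fin d → ℤ, ∫ ξ, exp ((∑ i, (r i : ℝ) * ξ i : ℝ) * I) ∂μ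
      = autocorr (fun x => f x - fourierCoeff f 0) (toTorus L r)) {k : TorusSite d L} (hk : k ≠ 0) :
    braggWeight μ ![dualVec k] = ‖fourierCoeff f k‖ ^ 2 := by
  rw [braggWeight_of_represents_autocorr _ μ hμ k, fourierCoeff_sub_const f _ hk]

/-- Connected form at the origin: no Bragg weight at `Q = 0`. -/
theorem braggWeight_origin_of_represents_connected_autocorr (μ : Measure (EuclideanSpace ℝ (Fin d)))
    [IsFiniteMeasure μ]
    (hμ : ∀ r : Fin d → ℤ, ∫ ξ, exp ((∑ i, (r i : ℝ) * ξ i : ℝ) * I) ∂μ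
      = autocorr (fun x => f x - fourierCoeff f 0) (toTorus L r)) :
    braggWeight μ ![dualVec (0 : TorusSite d L)] = 0 := by
  rw [braggWeight_of_represents_autocorr _ μ hμ 0, fourierCoeff_sub_mean_zero, norm_zero, sq, mul_zero]

/-- In particular the Bragg weights of a measure representing a pattern autocorrelation are bounded by Parseval:
`braggWeight μ ![dualVec k] ≤ L^{-d} Σ_x |f x|²` (one term of `sum_normSq_fourierCoeff`). -/
theorem braggWeight_of_represents_autocorr_le (μ : Measure (EuclideanSpace ℝ (Fin d))) [IsFiniteMeasure μ]
    (hμ : ∀ r : Fin d → ℤ, ∫ ξ, exp ((∑ i, (r i : ℝ) * ξ i : ℝ) * I) ∂μ = autocorr f (toTorus L r))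
    (k : TorusSite d L) :
    braggWeight μ ![dualVec k] ≤ ((L : ℝ) ^ d)⁻¹ * ∑ x, ‖f x‖ ^ 2 := by
  rw [braggWeight_of_represents_autocorr f μ hμ k]
  have hpar : ∑ k', ‖fourierCoeff f k'‖ ^ 2 = ((L : ℝ) ^ d)⁻¹ * ∑ x, ‖f x‖ ^ 2 := by
    have h := sum_normSq_fourierCoeff f
    apply Complex.ofReal_injective
    push_cast at h ⊢
    exact h
  rw [← hpar]
  exact Finset.single_le_sum (fun k' _ => sq_nonneg ‖fourierCoeff f k'‖) (Finset.mem_univ k)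

/-! ### §5. `d = 2` readings at the M3 stripe stars -/

section TwoDim

/-- Period `8`, `k = (1, 0)`: the folded dual-grid wavevector is the charge-stripe arm `Q_c = (π/4, 0)`. -/
theorem dualVec_eight_one_zero : dualVec (![1, 0] : TorusSite 2 8) = ![π / 4, 0] := by
  have h1 : ((1 : ZMod 8)).valMinAbs = 1 := by decide
  have h0 : ((0 : ZMod 8)).valMinAbs = 0 := by decide
  funext i
  fin_cases i
  · simp [h1]; ring
  · simp [h0]

/-- Period `16`, `k = (7, 8)`: the folded dual-grid wavevector is the spin-stripe arm `Q_s = (7π/8, π)`. -/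
theorem dualVec_sixteen_seven_eight : dualVec (![7, 8] : TorusSite 2 16) = ![7 * π / 8, π] := by
  have h7 : ((7 : ZMod 16)).valMinAbs = 7 := by decide
  have h8 : ((8 : ZMod 16)).valMinAbs = 8 := by decide
  funext i
  fin_cases i
  · simp [h7]; ring
  · simp [h8]; ring

/-- **Charge arm.**  For every `8`-periodic pattern `f` on `ℤ²` and every finite measure representing its
autocorrelation, the Bragg weight at `Q_c = (π/4, 0)` — the wavevector of the certified per-arm ceilings
`chargeArm_braggWeight_le_r262` / `_r258` — is exactly `|f̂(1, 0)|²`. -/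
theorem braggWeight_chargeArm_of_represents_autocorr (f : TorusSite 2 8 → ℂ)
    (μ : Measure (EuclideanSpace ℝ (Fin 2))) [IsFiniteMeasure μ]
    (hμ : ∀ r : Fin 2 → ℤ, ∫ ξ, exp ((∑ i, (r i : ℝ) * ξ i : ℝ) * I) ∂μ = autocorr f (toTorus 8 r)) :
    braggWeight μ ![![π / 4, 0]] = ‖fourierCoeff f ![1, 0]‖ ^ 2 := by
  rw [← dualVec_eight_one_zero]
  exact braggWeight_of_represents_autocorr f μ hμ _

/-- **Spin arm.**  For every `16`-periodic pattern `f` on `ℤ²` and every finite measure representing its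
autocorrelation, the Bragg weight at `Q_s = (7π/8, π)` — the wavevector of `spinArm_braggWeight_le_r263` / `_r259`
— is exactly `|f̂(7, 8)|²`. -/
theorem braggWeight_spinArm_of_represents_autocorr (f : TorusSite 2 16 → ℂ)
    (μ : Measure (EuclideanSpace ℝ (Fin 2))) [IsFiniteMeasure μ]
    (hμ : ∀ r : Fin 2 → ℤ, ∫ ξ, exp ((∑ i, (r i : ℝ) * ξ i : ℝ) * I) ∂μ = autocorr f (toTorus 16 r)) :
    braggWeight μ ![![7 * π / 8, π]] = ‖fourierCoeff f ![7, 8]‖ ^ 2 := by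
  rw [← dualVec_sixteen_seven_eight]
  exact braggWeight_of_represents_autocorr f μ hμ _

end TwoDim

end Summit.Ventures.CertifiedManyBodySolver.Observables
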